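import Mathlib
import Summits.Ventures.PercRepro2.SwOutMixedCubeLemma

/-!
# Tightness of the twisted cube lemma: the corner inclusion is necessary (blind cell PercRepro2,
night-4 g17, 2026-08-27; proofs/NIGHT4-G17.md §2)

`mixedCube_card_le` (SwOutMixedCubeLemma) and `mixedCubeFar_card_le'` (SwOutMixedCubeFarWeak) prove
the rigid inequality on the twisted cube minus the two core points under a lowerness hypothesis on
the conditioning set `Q`; the weak form `WeakLower` asks (i) the bottom layer to be a lower set,
(ii) the top-layer corner fibres to be lower sets of the far cube and (iii) the fibre of the upper
corner `X = A = true` to lie in the fibre of the lower corner `X = A = false`.  This file records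
that (iii) cannot be dropped: the set `Q₀ = {(t,t,t), (f,f,f), (f,t,f)}` (coordinates `(x, a, ε)`)
has a lower bottom layer, avoids the core points, contains the upper corner of the top layer but
not the lower one, and for the up-set `↑{A}` of atom sets its red count (2) exceeds its blue count
(1) — `mixedCube_corner_necessary`.  Adding the lower corner restores the inequality
(`mixedCube_corner_restores`).

This is the abstract shadow of the n = 10 witness t10c of NIGHT4-G17.md: the dropped piece carries
the red cluster of `l` through itself at `(same, r, r)`, and the flip of `X ∪ A ∪ ext` cuts it — the
point `(same, b, b)` leaves `Q` while `(same, r, r)` stays.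
-/

namespace Summit.Ventures.PercRepro2

namespace MixedCube

/-- The conditioning set of the witness, in the coordinates `(x, a, ε)` of `Pt`. -/
def Q₀ : Finset Pt := {(true, true, true), (false, false, false), (false, true, false)}

/-- The up-set `↑{A}` of atom sets. -/
def 𝓔A : Finset (Finset (Fin 2)) := {{1}, {0, 1}}

/-- `𝓔A` is an up-set. -/
theorem isUpperAtoms_𝓔A : IsUpperAtoms 𝓔A := by decide

/-- The bottom layer of `Q₀` is a lower set (a point below a bottom-layer point is in the bottom
layer, so this is lowerness in the coordinates `(x, a)`). -/
theorem Q₀_bottom_lower : IsLowerPts (Q₀.filter fun p => p.2.2 = false) := by decide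

/-- `Q₀` avoids the two core points. -/
theorem Q₀_disjoint_corePts : ∀ p ∈ Q₀, p ∉ corePts := by decide

/-- `Q₀` contains the upper corner of the top layer but not the lower one: the corner inclusion of
`WeakLower` fails. -/
theorem Q₀_corner_fails : (true, true, true) ∈ Q₀ ∧ (false, false, true) ∉ Q₀ := by decide

/-- **The corner inclusion is necessary**: on `Q₀` (bottom layer lower, core points avoided, corner
inclusion violated) the blue count for `↑{A}` is 1 and the red count is 2. -/
theorem mixedCube_corner_necessary :
    ((Q₀ \ corePts).filter fun p => EB p ∈ 𝓔A).card < ((Q₀ \ corePts).filter fun p => ER p ∈ 𝓔A).card := by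
  decide

/-- The same set with the lower corner added satisfies the inequality for `↑{A}` (2 ≤ 2). -/
theorem mixedCube_corner_restores :
    (((Q₀ ∪ {(false, false, true)}) \ corePts).filter fun p => ER p ∈ 𝓔A).card ≤
      (((Q₀ ∪ {(false, false, true)}) \ corePts).filter fun p => EB p ∈ 𝓔A).card := by
  decide

end MixedCube

end Summit.Ventures.PercRepro2
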